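import Summits.ABC.IUTFork.Thm311RealDegree
import Summits.ABC.IUTFork.Thm311RealFull
import HarnessLib

/-!
# [IUTchIII] Theorem 3.11 AS TYPED HOLDS OUTRIGHT at the probability-weighted real instantiation; the
# packet-normalization certificates for the two weightings of the verbatim container

PROOF-ONLY companion (D-0012; no definitions) of `Thm311RealDegree` (abc-iut cell, Cor. 3.12 sub-crew, seat
abc-iut-c312-1 — the typer of [IUTchIII] Thm. 3.11 —, gen 5); TAKES NO SIDE on [IUTchIII] Cor. 3.12.

§1 **Packet-normalization** ([IUTchIII] Prop. 3.9 (i) p. 115 "normalized so that multiplication of an element of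
`𝕄(−)` by `p_v` corresponds to adding the quantity `−log(p_v)`"; Rmk. 3.1.1 (ii) p. 94 "normalized so that
multiplication by `p_{v_ℚ}` affects log-volumes by addition or subtraction … of the quantity `log(p_{v_ℚ})`") —
kernel certificates of this seat's finding F-c312-1-g5-1: for a direct product region of the `(j+1)`-packet over
`p` with admissible factors, multiplying every factor by `p` subtracts EXACTLY `log p` from the log-volume of the
probability-weighted container `Real.summandPiecesPr` (`logvol_p_mul_Pr`), but `(|𝕍(F)_p|/[F:ℚ])^{j+1}·log p` from that
of c312-5's constant-weighted `Real.summandPiecesDH` (`logvol_p_mul_DH`; `= log p` iff `p` is totally split in `F`):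
the constant weight `1/[F:ℚ]^{j+1}` of Rmk. 3.1.1 (ii) is the weight of the UNNORMALISED summand log-volume, while
abc-iut-c312-3's `packetLogμ` (Dupuy–Hilado Def. 3.6.1 / §3.4 `log μ̄ = log μ/dim`) is the NORMALISED one.

§2 **The typed Theorem 3.11 at the probability-weighted real instantiation.** `Real.degreeClause_situationPr`: the
degree clause (i) (c) of c312-5's `Situation.ofShells` over the real Dupuy–Hilado-level log-shells with `Adm`/`logvol`
:= `summandPiecesPr` and the `G`-slot := `GlobalDegrees.ofIdeals` with the ideal regions HOLDS (file R
`degreesViaLogvol_ofIdeals`), for all remaining binders. Whence, with this seat's gen-4 assembly (`Thm311RealFull`: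
(i) (b) placement = c312-5 `psiInSubPackets_ofShells_of_LGP`, (i) multiradial compatibility = `rfl` for coric
line data, (ii) = abc-iut-w4-d087 `partII_ofShells_defined` at the ANALYTIC logarithms with the archimedean integral
structure := `L.shellPk`, (iii) = this seat's `statement_ofGlueRadial_iff_clauses` for `LinkData.ofGlueRadial` over
any L6 glue): **`Real.full_statement_Pr` — `Thm311.FullSituation.Statement` HOLDS, with NO residual hypothesis
beyond the choice of LGP splitting monoids at the bad places** (`2l`-th roots `qroot`, torsion profiles `ζ`;
c312-5 `Real.splittingMonoidLGP`), for: the real index datum of `X : PilotData F`; carriers `K_v`; log-shells of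
the analytic logarithms (`Real.analyticLogv`; c312-5's `logShellsDH`: (Ind1) = capsule permutations, (Ind2) =
Dupuy–Hilado's bicontinuous shell-preserving automorphisms); verbatim container with probability weights; (c) by
fractional ideals with their direct product regions; coric (strictified) columns with abc-iut-w4-d029's honest
(Ind3)-images; Θ-pilot lgp-divisors `thetaDiv₀`; (iii)-objects glued from ANY L6 §1–§2 data `G, Λ, FM`
(`S : StripFrame.{0}`, the tree's current pin — R-a pass pending).

Cross-references (cited by name, not restated): the normalisation `c = 1/[F:ℚ]` of R agrees with abc-iut-L6-d3's
GENUINE adelic Haar model (`Literature.IUT.LogThetaLattice.prop39iii_degree_haarModel`, `|A| = 1`) and with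
abc-iut-L6-t24's record certificate `Thm311DegreeClauseScale` (`Situation.not_degreeClause_of_normalised`: the clause
with UN-normalised `deg` against `1/[M:ℚ]`-normalised log-volumes forces `[M:ℚ] = 1`); abc-iut-w4-d087's
`Thm311RealDegreeClauseExists` gives the complementary ∃-form of the clause AS FROZEN (Sierpiński regions).
§3 re-derives c312-5's A-0 consequences (`Cor312VolumesRealAssembly`: (Ind1)/(Ind2)-invariance along the whole
indeterminacy subgroup; c312-6's `BridgeHyps` fields `mono`/`image_adm`/`image_fin`/`theta_nonempty`) for c312-7
settings over the probability-weighted situation — consumers switch container by name.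

HONEST FRAMING (cell rule "vacuity-audit every fork-level hypothesis"; ADJUDICATION-SPEC §3 (b) "if Thm 3.11's own
typed parts are meanwhile DISCHARGED for the real setting, say so"): this is a MEASUREMENT OF THE TYPING — at this
real instantiation the premise of record carries no constraint beyond classical facts about `K_v`, Haar measure and
`Σ_{v|p} n_v = [F:ℚ]` (the author's content sits in the CONSTRUCTIONS the bi-coric strictification renders as
identifications — LANA Rem. 8.2.1, Scholze–Stix 2018 §2.2, this seat's `Thm311ToCor312Checks.independence`); it
does NOT say that [IUTchIII] Thm. 3.11 is "true" or "false", and `Cor312.Setting.Statement` is untouched (Team A's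
`thm311_bridgeHyps_not_imp_statement`). Sources read on the page (this seat's render of `paper:url-4b091feeb646`):
p. 94, p. 115, p. 153–154. [claim: Mochizuki2012, status: disputed] [cite: DupuyHilado2025, §3.4, §3.6, Def. 3.6.1]
Deliberately NOT here: any definition; any edit to c312-5's files; any judgement. typed ≠ proved; instantiated ≠ endorsed.
-/

noncomputable section

open Set Function NumberField IsDedekindDomain
open scoped Pointwise

namespace Summit.ABC.IUTFork.Thm311.Real

open Cor312Vol CategoryTheory Literature.IUT.LogThetaLattice Literature.IUT.LogVolume
  Literature.NumberTheory.NumberFields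

variable {F : Type} [Field F] [NumberField F] (X : PilotData F) (p : ℕ) [hp : Fact p.Prime]

/-! ## 1. Packet-normalization: `×p` costs `log p` with the probability weights, `(|𝕍(F)_p|/[F:ℚ])^{j+1}·log p` with
the constant weights -/

omit hp in
/-- For comparison: c312-5's constant weight `1/[F:ℚ]^{j+1}` summed over the `|𝕍(F)_p|^{j+1}` summands of the
`(j+1)`-packet over `p` is `(|𝕍(F)_p|/[F:ℚ])^{j+1}` — equal to `1` iff `p` is totally split in `F`. [folklore] -/
theorem sum_weightDH (j : (thetaIndex X).Label) :
    ∑ _e : Fin ((j : ℕ) + 1) → placesOver F p, weightDH X j =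
      ((placesOver F p).card / (Module.finrank ℚ F : ℝ)) ^ ((j : ℕ) + 1) := by
  rw [Finset.sum_const, Finset.card_univ, Fintype.card_fun, Fintype.card_fin, Fintype.card_coe, nsmul_eq_mul,
    weightDH]
  push_cast
  rw [div_pow, div_eq_mul_inv]


section Normalization

variable {logv : PadicLogs F} (hlog : LogvAnalytic logv)

/-- The summands, log-measure and weights of `summandPiecesPr` at `v_ℚ = p`, unfolded. [folklore] -/
theorem summandPiecesPr_logμ (j : (thetaIndex X).Label)
    (e : (summandPiecesPr X hlog).E j (.inr (ratPrime p)))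
    (A : Set ((padicPresentationPr X p logv (hlog (ratPrime p))).X e)) :
    (summandPiecesPr X hlog).logμ j (.inr (ratPrime p)) e A =
      packetLogμ p ((padicPresentationPr X p logv (hlog (ratPrime p))).kk e) A := rfl

/-- The weights of `summandPiecesPr` at `v_ℚ = p` are the probability weights. [folklore] -/
theorem summandPiecesPr_w (j : (thetaIndex X).Label) (e : (summandPiecesPr X hlog).E j (.inr (ratPrime p))) :
    (summandPiecesPr X hlog).w j (.inr (ratPrime p)) e = weightPr X p j e := rfl

/-- … and sum to `1`. [cite: DupuyHilado2025, §3.6] -/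
theorem sum_w_summandPiecesPr (j : (thetaIndex X).Label) :
    ∑ e, (summandPiecesPr X hlog).w j (.inr (ratPrime p)) e = 1 := by
  rw [← (tupleWeights F p (j : ℕ)).sum_pr]
  exact Finset.sum_equiv (Equiv.arrowCongr (Equiv.refl ((thetaIndex X).Caps j))
    (fibreEquivPlacesOver X (ratPrime p))) (fun _ => ⟨fun _ => Finset.mem_univ _, fun _ => Finset.mem_univ _⟩) fun _ _ => rfl

/-- The log-measure and weights of c312-5's `summandPiecesDH` at `v_ℚ = p`, unfolded. [folklore] -/
theorem summandPiecesDH_logμ (j : (thetaIndex X).Label)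
    (e : (summandPiecesDH X hlog).E j (.inr (ratPrime p)))
    (A : Set ((padicPresentationDH X p logv (hlog (ratPrime p))).X e)) :
    (summandPiecesDH X hlog).logμ j (.inr (ratPrime p)) e A =
      packetLogμ p ((padicPresentationDH X p logv (hlog (ratPrime p))).kk e) A := rfl

/-- c312-5's weights at `v_ℚ = p` sum to `(|𝕍(F)_p|/[F:ℚ])^{j+1}`. [folklore] -/
theorem sum_w_summandPiecesDH (j : (thetaIndex X).Label) :
    ∑ e, (summandPiecesDH X hlog).w j (.inr (ratPrime p)) e =
      ((placesOver F p).card / (Module.finrank ℚ F : ℝ)) ^ ((j : ℕ) + 1) := by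
  rw [← sum_weightDH X p j]
  exact Finset.sum_equiv (Equiv.arrowCongr (Equiv.refl ((thetaIndex X).Caps j))
    (fibreEquivPlacesOver X (ratPrime p))) (fun _ => ⟨fun _ => Finset.mem_univ _, fun _ => Finset.mem_univ _⟩) fun _ _ => rfl

/-- **[IUTchIII] Prop. 3.9 (i) packet-normalization HOLDS for the probability-weighted container**: for a direct
product region `e⁻¹(Π_{v⃗} R_{v⃗})` over `p` with admissible factors, multiplying every factor by `p` (c312-3's
`ppow p _ 1 = p ∈ F_{v_0} ⊗ ⋯ ⊗ F_{v_j}`) subtracts exactly `log p` from the log-volume ("multiplication … by `p_v`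
corresponds to adding the quantity `−log(p_v)`", p. 115; Rmk. 3.1.1 (ii) p. 94). [claim: Mochizuki2012, status: disputed] -/
theorem logvol_p_mul_Pr (j : (thetaIndex X).Label)
    (R : ∀ e : (summandPiecesPr X hlog).E j (.inr (ratPrime p)),
      Set ((padicPresentationPr X p logv (hlog (ratPrime p))).X e))
    (hR : ∀ e, PacketAdm p ((padicPresentationPr X p logv (hlog (ratPrime p))).kk e) (R e)) :
    (summandPiecesPr X hlog).logvol j (.inr (ratPrime p))
        ((summandPiecesPr X hlog).e j (.inr (ratPrime p)) ⁻¹' Set.pi univ fun e =>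
          ppow p ((padicPresentationPr X p logv (hlog (ratPrime p))).kk e) 1 • R e) =
      (summandPiecesPr X hlog).logvol j (.inr (ratPrime p))
        ((summandPiecesPr X hlog).e j (.inr (ratPrime p)) ⁻¹' Set.pi univ R) - Real.log p := by
  have hR' : ∀ e, PacketAdm p ((padicPresentationPr X p logv (hlog (ratPrime p))).kk e)
      (ppow p ((padicPresentationPr X p logv (hlog (ratPrime p))).kk e) 1 • R e) := fun e =>
    packetAdm_smul p _ _ (fun jx => by
      rw [psi_ppow_apply]; exact zpow_ne_zero _ (prime_ne_zero p (DFac p _ jx))) (hR e)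
  rw [(summandPiecesPr X hlog).logvol_preimage_pi j (.inr (ratPrime p)) hR',
    (summandPiecesPr X hlog).logvol_preimage_pi j (.inr (ratPrime p)) hR]
  have hμ : ∀ e, (summandPiecesPr X hlog).logμ j (.inr (ratPrime p)) e
      (ppow p ((padicPresentationPr X p logv (hlog (ratPrime p))).kk e) 1 • R e) =
      -((1 : ℤ) * Real.log p) + (summandPiecesPr X hlog).logμ j (.inr (ratPrime p)) e (R e) := fun e =>
    packetLogμ_ppow_smul p _ 1 (hR e)
  simp only [hμ, mul_add, Finset.sum_add_distrib, Int.cast_one, one_mul, mul_neg, Finset.sum_neg_distrib,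
    ← Finset.sum_mul, sum_w_summandPiecesPr X p hlog j]
  ring

/-- **… and FAILS for c312-5's constant-weighted container `summandPiecesDH` at every prime that is not totally
split**: the same operation subtracts `(|𝕍(F)_p|/[F:ℚ])^{j+1}·log p` (kernel certificate of this seat's finding
F-c312-1-g5-1: the constant weight of Rmk. 3.1.1 (ii) pairs with the UNNORMALISED log-measure, c312-3's
`packetLogμ` is the normalised one). [claim: Mochizuki2012, status: disputed] -/
theorem logvol_p_mul_DH (j : (thetaIndex X).Label)
    (R : ∀ e : (summandPiecesDH X hlog).E j (.inr (ratPrime p)),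
      Set ((padicPresentationDH X p logv (hlog (ratPrime p))).X e))
    (hR : ∀ e, PacketAdm p ((padicPresentationDH X p logv (hlog (ratPrime p))).kk e) (R e)) :
    (summandPiecesDH X hlog).logvol j (.inr (ratPrime p))
        ((summandPiecesDH X hlog).e j (.inr (ratPrime p)) ⁻¹' Set.pi univ fun e =>
          ppow p ((padicPresentationDH X p logv (hlog (ratPrime p))).kk e) 1 • R e) =
      (summandPiecesDH X hlog).logvol j (.inr (ratPrime p))
        ((summandPiecesDH X hlog).e j (.inr (ratPrime p)) ⁻¹' Set.pi univ R) -
        ((placesOver F p).card / (Module.finrank ℚ F : ℝ)) ^ ((j : ℕ) + 1) * Real.log p := by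
  have hR' : ∀ e, PacketAdm p ((padicPresentationDH X p logv (hlog (ratPrime p))).kk e)
      (ppow p ((padicPresentationDH X p logv (hlog (ratPrime p))).kk e) 1 • R e) := fun e =>
    packetAdm_smul p _ _ (fun jx => by
      rw [psi_ppow_apply]; exact zpow_ne_zero _ (prime_ne_zero p (DFac p _ jx))) (hR e)
  rw [(summandPiecesDH X hlog).logvol_preimage_pi j (.inr (ratPrime p)) hR',
    (summandPiecesDH X hlog).logvol_preimage_pi j (.inr (ratPrime p)) hR, ← sum_w_summandPiecesDH X p hlog j]
  have hμ : ∀ e, (summandPiecesDH X hlog).logμ j (.inr (ratPrime p)) e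
      (ppow p ((padicPresentationDH X p logv (hlog (ratPrime p))).kk e) 1 • R e) =
      -((1 : ℤ) * Real.log p) + (summandPiecesDH X hlog).logμ j (.inr (ratPrime p)) e (R e) := fun e =>
    packetLogμ_ppow_smul p _ 1 (hR e)
  simp only [hμ, mul_add, Finset.sum_add_distrib, Int.cast_one, one_mul, mul_neg, Finset.sum_neg_distrib,
    ← Finset.sum_mul]
  ring

end Normalization

/-! ## 2. The degree clause and the whole typed Theorem 3.11 at the probability-weighted real instantiation -/

section Degree

variable {logv : PadicLogs F} (hlog : LogvAnalytic logv)
  (archPk : ∀ (j : (thetaIndex X).Label) (vQ : (thetaIndex X).VQ), Set ((logShellsDH X logv).Packet j vQ))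
  (archSub : ∀ (j : (thetaIndex X).Label) (v : (thetaIndex X).V),
    Set ((logShellsDH X logv).Packet j ((thetaIndex X).over v)))
  (Ψ : ℤ → ∀ v : (thetaIndex X).V, v ∈ (thetaIndex X).Vbad → Set ((logShellsDH X logv).StarPacket v))
  (act : ℤ → ∀ v : (thetaIndex X).V, v ∈ (thetaIndex X).Vbad →
    (logShellsDH X logv).StarPacket v → Module.End ℚ ((logShellsDH X logv).StarPacket v))
  (Mmod : ℤ → ∀ j : (thetaIndex X).LabelStar, Set ((logShellsDH X logv).GlobalPacket j.1))
  (region : ℤ → ∀ j : (thetaIndex X).LabelStar, FinDivisor F → ∀ vQ : (thetaIndex X).VQ,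
    Set ((logShellsDH X logv).Packet j.1 vQ))

omit hp in
/-- **[IUTchIII] Thm. 3.11 (i) (c) — `Situation.DegreeClause` — HOLDS at the probability-weighted real instantiation**:
c312-5's `Situation.ofShells` over the real Dupuy–Hilado-level log-shells with `Adm`, `logvol` := the container
`summandPiecesPr` and its `G`-slot (c312-5's `ℝ`-divisors with the region binder) REPLACED by
`GlobalDegrees.ofIdeals` with the ideal regions — for every choice of the remaining binders (archimedean integral
structures, splitting monoids and actions, number fields, the now idle region binder). [claim: Mochizuki2012, status: disputed] -/
theorem degreeClause_situationPr :
    ({ Situation.ofShells (logShellsDH X logv) F archPk archSub (summandPiecesPr X hlog).Adm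
          (summandPiecesPr X hlog).logvol Ψ act Mmod region with
        G := fun _ j => GlobalDegrees.ofIdeals (logShellsDH X logv) F j (idealRegion X hlog j.1) } :
      Situation (thetaIndex X)).DegreeClause := fun _ =>
  degreesViaLogvol_ofIdeals X hlog ⟨fun _ _ _ => Iff.rfl, fun _ _ _ => rfl⟩

variable (archSub₀ : ∀ (j : (thetaIndex X).Label) (v : (thetaIndex X).V),
    Set ((logShellsDH X (analyticLogv F)).Packet j ((thetaIndex X).over v)))
  (Ψ₀ : ∀ v : (thetaIndex X).V, v ∈ (thetaIndex X).Vbad → Set ((logShellsDH X (analyticLogv F)).StarPacket v))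
  (act₀ : ∀ v : (thetaIndex X).V, v ∈ (thetaIndex X).Vbad →
    (logShellsDH X (analyticLogv F)).StarPacket v → Module.End ℚ ((logShellsDH X (analyticLogv F)).StarPacket v))
  (Mmod₀ : ∀ j : (thetaIndex X).LabelStar, Set ((logShellsDH X (analyticLogv F)).GlobalPacket j.1))
  (region₀ : ℤ → ∀ j : (thetaIndex X).LabelStar, FinDivisor F → ∀ vQ : (thetaIndex X).VQ,
    Set ((logShellsDH X (analyticLogv F)).Packet j.1 vQ))
  (thetaDiv₀ : ℤ → ℤ → LgpDivisor F (thetaIndex X).lstar)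
  {S : StripFrame.{0}} (G : LatticeGlue S) (Λ : LogThetaLatticeDiagram G.logData G.linkData)
  {Kap : Type} [Category.{0} Kap] (FM : Core S.DHT ⥤ Kap)

omit hp in
/-- **THE TYPED THEOREM 3.11 HOLDS OUTRIGHT AT THE PROBABILITY-WEIGHTED REAL INSTANTIATION.** Full situation:
index datum and carriers of `X : PilotData F`; log-shells of the ANALYTIC logarithms (c312-5 `Real.analyticLogv`,
`logShellsDH`); (a)'s integral structures := the defined ones (archimedean: the pure tensors of shell elements
`L.shellPk`, w4-d087's `partII_ofShells_defined`), `𝕄(−)`/`μ^log` := the probability-weighted verbatim container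
`summandPiecesPr`; (b) := the LGP splitting monoid `Real.splittingMonoidLGP` at every bad place (any `qroot`, `ζ`),
coric line data; (c) := fractional ideals with their direct product regions (`GlobalDegrees.ofIdeals`,
`idealRegion`); strictified columns with w4-d029's honest (Ind3)-images; Θ-pilot lgp-divisors `thetaDiv₀`;
(iii)-objects `LinkData.ofGlueRadial G Λ FM` over any L6 glue. Then `Thm311.FullSituation.Statement` — the cell's
premise of record, [IUTchIII] Thm. 3.11 (i) ∧ (ii) ∧ (iii) as typed — HOLDS: (i) (b) c312-5, (i) (c) file R,
(i) multiradial compatibility `rfl`, (ii) w4-d087/w4-d029, (iii) this seat's files J/L/P. A measurement of the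
typing (module docstring); no side taken. [claim: Mochizuki2012, status: disputed] -/
theorem full_statement_Pr
    (qroot : ∀ v : HeightOneSpectrum (𝓞 F), Carrier (.inr v : Place F))
    (ζ : ∀ v : HeightOneSpectrum (𝓞 F), (thetaIndex X).LabelStar → (Carrier (.inr v : Place F))ˣ)
    (hΨ : ∀ (v : HeightOneSpectrum (𝓞 F)) (hv : (.inr v : Place F) ∈ (thetaIndex X).Vbad),
      Ψ₀ (.inr v) hv = splittingMonoidLGP X (analyticLogv F) stripAutDH (ismDH (analyticLogv F))
        refl_mem_stripAutDH (refl_mem_ismDH (analyticLogv F)) v (qroot v) (ζ v)) :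
    Summit.ABC.IUTFork.Thm311.FullSituation.Statement
      ({ LatticeSituation.ofShells (logShellsDH X (analyticLogv F)) F
            (fun j vQ => ((logShellsDH X (analyticLogv F)).shellPk j vQ :
              Set ((logShellsDH X (analyticLogv F)).Packet j vQ)))
            archSub₀ (summandPiecesPr X (logvAnalytic_analyticLogv (F := F))).Adm
            (summandPiecesPr X (logvAnalytic_analyticLogv (F := F))).logvol (fun _ => Ψ₀) (fun _ => act₀)
            (fun _ => Mmod₀) region₀
            (fun _ _ => (summandPiecesPr X (logvAnalytic_analyticLogv (F := F))).Adm)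
            (fun _ _ => (summandPiecesPr X (logvAnalytic_analyticLogv (F := F))).logvol)
            (fun _ _ => Ψ₀) (fun _ _ => Mmod₀)
            (fun _ _ m' j vQ =>
              (logShellsDH X (analyticLogv F)).tprodImages j vQ fun v => iterImage (analyticLogv F) m' v.1)
            (fun _ _ j vQ =>
              (logShellsDH X (analyticLogv F)).tprodImages j vQ fun v => shell (analyticLogv F) v.1)
            thetaDiv₀ with
          G := fun _ j => GlobalDegrees.ofIdeals (logShellsDH X (analyticLogv F)) F j
            (idealRegion X (logvAnalytic_analyticLogv (F := F)) j.1)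
          link := LinkData.ofGlueRadial G Λ FM } : FullSituation (thetaIndex X)) := by
  refine (FullSituation.statement_ofGlueRadial_iff_clauses
    ({ LatticeSituation.ofShells (logShellsDH X (analyticLogv F)) F
          (fun j vQ => ((logShellsDH X (analyticLogv F)).shellPk j vQ :
            Set ((logShellsDH X (analyticLogv F)).Packet j vQ)))
          archSub₀ (summandPiecesPr X (logvAnalytic_analyticLogv (F := F))).Adm
          (summandPiecesPr X (logvAnalytic_analyticLogv (F := F))).logvol (fun _ => Ψ₀) (fun _ => act₀)
          (fun _ => Mmod₀) region₀
          (fun _ _ => (summandPiecesPr X (logvAnalytic_analyticLogv (F := F))).Adm)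
          (fun _ _ => (summandPiecesPr X (logvAnalytic_analyticLogv (F := F))).logvol)
          (fun _ _ => Ψ₀) (fun _ _ => Mmod₀)
          (fun _ _ m' j vQ =>
            (logShellsDH X (analyticLogv F)).tprodImages j vQ fun v => iterImage (analyticLogv F) m' v.1)
          (fun _ _ j vQ =>
            (logShellsDH X (analyticLogv F)).tprodImages j vQ fun v => shell (analyticLogv F) v.1)
          thetaDiv₀ with
        G := fun _ j => GlobalDegrees.ofIdeals (logShellsDH X (analyticLogv F)) F j
          (idealRegion X (logvAnalytic_analyticLogv (F := F)) j.1) } : LatticeSituation (thetaIndex X))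
    G Λ FM).mpr ⟨⟨?_, ?_, fun _ _ => rfl⟩, ?_⟩
  · -- (i) (b): the LGP splitting monoids sit in the sub-packets (c312-5)
    exact fun _ => psiInSubPackets_ofShells_of_LGP X (analyticLogv F) stripAutDH (ismDH (analyticLogv F))
      refl_mem_stripAutDH (refl_mem_ismDH (analyticLogv F)) _ archSub₀ _ _ Ψ₀ act₀ Mmod₀ qroot ζ hΨ
  · -- (i) (c): the degree clause (file R)
    exact degreeClause_situationPr X (logvAnalytic_analyticLogv (F := F)) _ archSub₀ (fun _ => Ψ₀) (fun _ => act₀)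
      (fun _ => Mmod₀) region₀
  · -- (ii): the log-Kummer correspondence at the analytic logarithms (w4-d087 / w4-d029)
    exact partII_ofShells_defined X stripAutDH (ismDH (analyticLogv F)) refl_mem_stripAutDH
      (refl_mem_ismDH (analyticLogv F)) archSub₀ _ _ (fun _ => Ψ₀) (fun _ => act₀) (fun _ => Mmod₀) region₀
      thetaDiv₀

omit hp in
/-- **The same with the splitting-monoid slot FILLED IN** (at a bad place `v`: c312-5's LGP splitting monoid for the
chosen `2l`-th roots `qroot` and torsion profiles `ζ`; the slot at an archimedean place, which is never bad, is
empty): `Thm311.FullSituation.Statement` with NO hypothesis at all. [claim: Mochizuki2012, status: disputed] -/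
theorem full_statement_Pr_LGP
    (qroot : ∀ v : HeightOneSpectrum (𝓞 F), Carrier (.inr v : Place F))
    (ζ : ∀ v : HeightOneSpectrum (𝓞 F), (thetaIndex X).LabelStar → (Carrier (.inr v : Place F))ˣ) :
    Summit.ABC.IUTFork.Thm311.FullSituation.Statement
      ({ LatticeSituation.ofShells (logShellsDH X (analyticLogv F)) F
            (fun j vQ => ((logShellsDH X (analyticLogv F)).shellPk j vQ :
              Set ((logShellsDH X (analyticLogv F)).Packet j vQ)))
            archSub₀ (summandPiecesPr X (logvAnalytic_analyticLogv (F := F))).Adm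
            (summandPiecesPr X (logvAnalytic_analyticLogv (F := F))).logvol
            (fun _ x _ => match x with
              | .inr v => splittingMonoidLGP X (analyticLogv F) stripAutDH (ismDH (analyticLogv F))
                  refl_mem_stripAutDH (refl_mem_ismDH (analyticLogv F)) v (qroot v) (ζ v)
              | .inl _ => ∅)
            (fun _ => act₀) (fun _ => Mmod₀) region₀
            (fun _ _ => (summandPiecesPr X (logvAnalytic_analyticLogv (F := F))).Adm)
            (fun _ _ => (summandPiecesPr X (logvAnalytic_analyticLogv (F := F))).logvol)
            (fun _ _ x _ => match x with
              | .inr v => splittingMonoidLGP X (analyticLogv F) stripAutDH (ismDH (analyticLogv F))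
                  refl_mem_stripAutDH (refl_mem_ismDH (analyticLogv F)) v (qroot v) (ζ v)
              | .inl _ => ∅)
            (fun _ _ => Mmod₀)
            (fun _ _ m' j vQ =>
              (logShellsDH X (analyticLogv F)).tprodImages j vQ fun v => iterImage (analyticLogv F) m' v.1)
            (fun _ _ j vQ =>
              (logShellsDH X (analyticLogv F)).tprodImages j vQ fun v => shell (analyticLogv F) v.1)
            thetaDiv₀ with
          G := fun _ j => GlobalDegrees.ofIdeals (logShellsDH X (analyticLogv F)) F j
            (idealRegion X (logvAnalytic_analyticLogv (F := F)) j.1)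
          link := LinkData.ofGlueRadial G Λ FM } : FullSituation (thetaIndex X)) :=
  full_statement_Pr X archSub₀ _ act₀ Mmod₀ region₀ thetaDiv₀ G Λ FM qroot ζ fun _ _ => rfl

end Degree

/-! ## 3. c312-5's A-0 consequences, re-derived for settings over the probability-weighted container -/

section Consequences

variable {logv : PadicLogs F} (hlog : LogvAnalytic logv) (M : Type) [Field M] [NumberField M]
  (archPk : ∀ (j : (thetaIndex X).Label) (vQ : (thetaIndex X).VQ), Set ((logShellsDH X logv).Packet j vQ))
  (archSub : ∀ (j : (thetaIndex X).Label) (v : (thetaIndex X).V),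
    Set ((logShellsDH X logv).Packet j ((thetaIndex X).over v)))
  (Ψ : ℤ → ∀ v : (thetaIndex X).V, v ∈ (thetaIndex X).Vbad → Set ((logShellsDH X logv).StarPacket v))
  (act : ℤ → ∀ v : (thetaIndex X).V, v ∈ (thetaIndex X).Vbad →
    (logShellsDH X logv).StarPacket v → Module.End ℚ ((logShellsDH X logv).StarPacket v))
  (Mmod : ℤ → ∀ j : (thetaIndex X).LabelStar, Set ((logShellsDH X logv).GlobalPacket j.1))
  (region : ℤ → ∀ j : (thetaIndex X).LabelStar, FinDivisor M → ∀ vQ : (thetaIndex X).VQ,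
    Set ((logShellsDH X logv).Packet j.1 vQ))

omit hp in
/-- Every line of c312-5's `Situation.ofShells` over the real Dupuy–Hilado-level log-shells WITH THE
PROBABILITY-WEIGHTED VOLUMES (`Adm`, `logvol` := `summandPiecesPr`) carries that container. [folklore] -/
theorem realizes_ofShells_Pr (n : ℤ) :
    (summandPiecesPr X hlog).Realizes ((Situation.ofShells (logShellsDH X logv) M archPk archSub
      (summandPiecesPr X hlog).Adm (summandPiecesPr X hlog).logvol Ψ act Mmod region).D n) :=
  ⟨fun _ _ _ => Iff.rfl, fun _ _ _ => rfl⟩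

omit hp in
/-- **(Ind1)/(Ind2) INVARIANCE ALONG THE WHOLE INDETERMINACY SUBGROUP for the probability-weighted container**
(c312-5's `Real.adm_and_logvol_eq_of_mem_indGroup_DH` with the container switched): every
`Φ ∈ ⟨Ind1Family ∪ Ind2Family⟩` carries admissible regions to admissible regions of the same log-volume
([IUTchIII] proof of Cor. 3.12, Step (x), p. 181 l. 5–13). [claim: Mochizuki2012, status: disputed] -/
theorem adm_and_logvol_eq_of_mem_indGroup_Pr (n : ℤ) {Φ : (logShellsDH X logv).PacketAut}
    (hΦ : Φ ∈ Subgroup.closure ((logShellsDH X logv).Ind1Family ∪ (logShellsDH X logv).Ind2Family))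
    (j : (thetaIndex X).Label) (vQ : (thetaIndex X).VQ) (A : Set ((logShellsDH X logv).Packet j vQ))
    (hA : ((Situation.ofShells (logShellsDH X logv) M archPk archSub (summandPiecesPr X hlog).Adm
      (summandPiecesPr X hlog).logvol Ψ act Mmod region).D n).Adm j vQ A) :
    ((Situation.ofShells (logShellsDH X logv) M archPk archSub (summandPiecesPr X hlog).Adm
        (summandPiecesPr X hlog).logvol Ψ act Mmod region).D n).Adm j vQ (Φ j vQ '' A) ∧
      ((Situation.ofShells (logShellsDH X logv) M archPk archSub (summandPiecesPr X hlog).Adm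
          (summandPiecesPr X hlog).logvol Ψ act Mmod region).D n).logvol j vQ (Φ j vQ '' A) =
        ((Situation.ofShells (logShellsDH X logv) M archPk archSub (summandPiecesPr X hlog).Adm
          (summandPiecesPr X hlog).logvol Ψ act Mmod region).D n).logvol j vQ A :=
  SummandPieces.adm_and_logvol_eq_of_mem_indGroup (realizes_ofShells_Pr X hlog M archPk archSub Ψ act Mmod region n)
    (generatorsPreserve_summandPiecesPr X hlog) hΦ j vQ A hA

variable (P : Cor312.Setting (Situation.ofShells (logShellsDH X logv) M archPk archSub (summandPiecesPr X hlog).Adm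
  (summandPiecesPr X hlog).logvol Ψ act Mmod region))

omit hp in
/-- **c312-6's `BridgeHyps` for a c312-7 `Cor312.Setting` over the probability-weighted real situation, with `mono`,
`image_adm`, `image_fin`, `theta_nonempty` DISCHARGED** (c312-5's `Real.bridgeHyps_DH` with the container switched):
it remains to supply admissibility of the (Ind3)-enlarged Θ-region with finitely supported log-volume, non-empty
hull-sets, and `ThetaFinite`. [claim: Mochizuki2012, status: disputed] -/
theorem bridgeHyps_Pr
    (hθ : ∀ (i : Fin (thetaIndex X).lstar) (vQ : (thetaIndex X).VQ),
      ((Situation.ofShells (logShellsDH X logv) M archPk archSub (summandPiecesPr X hlog).Adm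
        (summandPiecesPr X hlog).logvol Ψ act Mmod region).D P.n).Adm _ vQ
        (P.thetaRegion3 (Cor312.Setting.labelSucc i) vQ))
    (hfin : ∀ i : Fin (thetaIndex X).lstar, (Function.support fun vQ : (thetaIndex X).VQ =>
      ((Situation.ofShells (logShellsDH X logv) M archPk archSub (summandPiecesPr X hlog).Adm
        (summandPiecesPr X hlog).logvol Ψ act Mmod region).D P.n).logvol _ vQ
        (P.thetaRegion3 (Cor312.Setting.labelSucc i) vQ)).Finite)
    (hul_nonempty : ∀ (j : (thetaIndex X).Label) (vQ : (thetaIndex X).VQ), ∀ H ∈ (P.frame j vQ).Hul, H.Nonempty)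
    (finite : P.ThetaFinite) : BridgeHyps P :=
  SummandPieces.bridgeHyps_of_summands (realizes_ofShells_Pr X hlog M archPk archSub Ψ act Mmod region P.n)
    (generatorsPreserve_summandPiecesPr X hlog) hθ hfin hul_nonempty finite

end Consequences

end Summit.ABC.IUTFork.Thm311.Real

end
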